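import Literature.AlgebraicGeometry.HodgeTheory.ChernCharacterBettiRescale
import Literature.AlgebraicGeometry.Motives.AbelianVariety
import HarnessLib

/-!
# Crux `HeckePrymWeil.HyperbolicEightfoldsSqrtMinus7` (stmt-HodgeConjecture-14642), line `euler-squeeze-rank-two-secant-bundle`:
# why skeleton v1's Stub B was reshaped (lead a1-0, cycle 1)

The crux-plan skeleton v1 (`Cruxes/HyperbolicEightfoldsSqrtMinus7/Lines/euler_squeeze_rank_two_secant_bundle.lean`, sha 7a377a0d)
typed the rigid rank-2 secant bundle (Stub B, `RigidSecantBundle47`) with the polarization class `θ` FIXED before the quantifier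
`∀ C : StandardChernCharacterBetti` and the clause `C.ch X.X F 2 = -(7 • θ²)` (with `θ⁴ ≠ 0`).  The hypothesis structure
`StandardChernCharacterBetti` is closed under the rescaling `chᵢ ↦ tⁱ·chᵢ`, `t ∈ ℚˣ`
(`Literature/AlgebraicGeometry/HodgeTheory/ChernCharacterBettiRescale`, `StandardChernCharacterBetti.rescale`), so a FIXED Betti
class that is `C.ch₂(F)` for every `C` vanishes as soon as one `C` exists (`eq_zero_of_forall_ch_eq_of_nonempty`).  Hence v1's Stub B
and Stub C (`Nonempty StandardChernCharacterBetti`) were jointly inconsistent.  This file records that fact as a closed theorem over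
the unfolded clause (no line-local definition is needed): `secantChernTwo_fixedTheta_inconsistent`.  Skeleton v2 (lead a1-0) asks
the identity per `C` up to `θ ↦ t·θ`, `t ∈ ℚˣ`.
-/

noncomputable section

-- single-problem summit (Problem = Summit): the mandated namespace repeats `HodgeConjecture`.
set_option linter.dupNamespace false

open CategoryTheory AlgebraicGeometry
open Literature.AlgebraicGeometry Literature.AlgebraicGeometry.Motives Literature.AlgebraicGeometry.HodgeTheory
open Literature.AlgebraicTopology.SingularHomology

namespace Summit.HodgeConjecture.HodgeConjecture.Theorems.HyperbolicEightfoldsSqrtMinus7.EulerSqueeze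

/-- `θ² = 0 ⟹ θ⁴ = 0` for cup powers of a degree-`2` class (`θ⁴ = ((θ² ∪ θ) ∪ θ)`, and `∪` is bilinear).
[cite: HatcherAT2002, §3.2] -/
theorem cupPowTwo_four_eq_zero_of_two {Y : Type} [TopologicalSpace Y] (θ : singularCohomology ℂ ℂ Y 2)
    (h : cupPowTwo θ 2 = 0) : cupPowTwo θ 4 = 0 := by
  rw [show (4 : ℕ) = 2 + 1 + 1 from rfl, cupPowTwo_succ, cupPowTwo_succ, h, map_zero, LinearMap.zero_apply, map_zero,
    LinearMap.zero_apply]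

/-- **The v1 typing of the secant Chern identity is inconsistent with the existence of a standard Chern character theory.**
If a module `F` on a `ℂ`-scheme `X` satisfied `C.ch₂(F) = -(7 • θ²)` for EVERY `C : StandardChernCharacterBetti` with one FIXED
class `θ`, then `7 • θ² = 0` (compare `C` with `C.rescale 2`: a fixed class that is `C.chᵢ` for all `C`, `i ≥ 1`, is `0`), hence
`θ² = 0` and `θ⁴ = 0` — contradicting the non-degeneracy clause `θ⁴ ≠ 0` of v1's Stub B.  (This is why skeleton v2 of the line
quantifies the normalisation `t ∈ ℚˣ`, `θ ↦ t·θ`, inside `∀ C`.) [cite: Fulton1998, Example 3.2.3]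
[cite: Markman2025SecantWeil, §8.2 Question 8.2.4] -/
theorem secantChernTwo_fixedTheta_inconsistent (hC : Nonempty StandardChernCharacterBetti) {X : SchemeOver ℂ}
    (F : X.left.Modules) (θ : complexBetti X 2) (hθ : cupPowTwo θ 4 ≠ 0)
    (h : ∀ C : StandardChernCharacterBetti, C.ch X F 2 = -((7 : ℂ) • cupPowTwo θ 2)) : False := by
  have h0 : -((7 : ℂ) • cupPowTwo θ 2) = 0 :=
    StandardChernCharacterBetti.eq_zero_of_forall_ch_eq_of_nonempty hC F (by norm_num) h
  have h2 : cupPowTwo θ 2 = 0 := by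
    rw [neg_eq_zero] at h0
    rw [← inv_smul_smul₀ (by norm_num : (7 : ℂ) ≠ 0) (cupPowTwo θ 2), h0, smul_zero]
  exact hθ (cupPowTwo_four_eq_zero_of_two θ h2)

/-- The same for an ABELIAN FOURFOLD carrier, in the exact shape of v1's Stub B (`X.X` for `X : AbelianVariety ℂ`): no `F`, `θ`
with `θ⁴ ≠ 0` satisfy the fixed-`θ` identity for all standard theories once one exists. [cite: Fulton1998, Example 3.2.3] -/
theorem secantChernTwo_fixedTheta_inconsistent_abelian : Nonempty StandardChernCharacterBetti → ∀ (X : AbelianVariety ℂ) (F : X.X.left.Modules) (θ : complexBetti X.X 2), cupPowTwo θ 4 ≠ 0 → (∀ C : StandardChernCharacterBetti, C.ch X.X F 2 = -((7 : ℂ) • cupPowTwo θ 2)) → False :=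
  fun hC _ F θ hθ h => secantChernTwo_fixedTheta_inconsistent hC F θ hθ h

end Summit.HodgeConjecture.HodgeConjecture.Theorems.HyperbolicEightfoldsSqrtMinus7.EulerSqueeze

end
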